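import Mathlib
import HarnessLib
import Summits.HubbardSuperconductivity.HubbardSuperconductivity.Theorems.KLProgrammeKLRegimeCountertermOneVolumeJS
import Summits.HubbardSuperconductivity.HubbardSuperconductivity.Theorems.KLProgrammeKLRegimeCountertermContinuationJA

/-!
# Route `KLProgramme` — child Counterterm of crux K3: THE ONE-VOLUME CONSTRUCTION, ADMISSIBILITY CLASS AND SELF-MAP ABSTRACT
# (seat hubbard-kl-k3c3-p2, «fixed point on FrameOK's tube»; twin of `…CountertermOneVolumeJS` — the frame class abstracted away too)

`ct_oneVolume_thresholdsJS` (`…CountertermOneVolumeJS`, p497366) with the admissibility class abstracted as well (`…ContinuationJA`): the frame class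
is a family `A β U μ : TrigPolyC4v → Prop` with ONE bridge `hAF : A β U μ K → FrameOK (ctRenMs G) U (nScales β) μ K`, and the PROVIDER supplies, under
its own regime thresholds `c₄, U₄`, the zero frame `A β U μ 0`, a Jackson DEGREE `d` meeting the one displacement condition `(1+q)(1+2q)·π⁶B₁/(d+1) ≤ |U|16^{−N}/256` (so a degree-capped
class can pick `d` under its cap — `jacksonDeg_cond` gives the canonical `d = ⌈π⁶B₁(1+q)(1+2q)·256·16^N/|U|⌉₊`), and the step
`A β U μ K → (∀ i ≤ n, X L M β U μ K i) → A β U μ (ctIterJ L M d β U μ K n)` at that `d`.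
So a bundle whose frame slot is `FrameOK ∧ (extra clause)` (e.g. the (R-deg) degree cap of p1b g7's F2 repair menu, SCALE0-TWOLEG-EXPORTS.md, evidence
#25 on 19918 — Jackson means have degree `2d` by `rfl`) and/or whose (E3a-MS) clause is re-typed re-closes child 2 by: provider + bridge + this theorem +
the bundle one-liner.

* **`ct_oneVolume_thresholdsJA`** — thresholds `c₁, U₀`, ONE volume `(L₀, M₀)` past any `(Lh, Mh, M0)` with `CL n/L₀ ≤ ½·tol_n`, and at it: every
  block keyed on `A β U μ` (any history `H`, the abstract `X`) yields a frame IN THE CLASS `A β U μ` renormalised to HALF tolerance at every scale and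
  real angle.
Proofs only; nothing is asserted about the Hubbard model.
-/

noncomputable section

namespace Summit.HubbardSuperconductivity.HubbardSuperconductivity.Theorems.KLRegimeSplit

set_option linter.dupNamespace false -- summit = problem name (single-conjunct summit), D-0017

open Real Finset
open Literature.MathematicalPhysics.QuantumLattice Literature.Probability.LatticeModels
open Summit.HubbardSuperconductivity.HubbardSuperconductivity.Theorems.KLProgrammeLegKernels

/-! ## The thresholds of the one-volume construction, admissibility class and self-map abstract -/

/-- **THRESHOLDS AND THE VOLUME OF CHILD 2's CONSTRUCTION, ADMISSIBILITY CLASS AND SELF-MAP ABSTRACT.**  For `G, Q`, a frame class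
`A β U μ` inside `FrameOK (ctRenMs G) U (nScales β) μ` (bridge `hAF`), an abstract per-scale slot conjunct `X`, and a PROVIDER (thresholds `c₄, U₄`: the
zero frame is in the class; a Jackson degree `d` with the displacement condition; the smoothed iterate of degree `d` of a class frame with the
`X`-conjuncts at the scales `≤ n` is in the class — every volume), there are `c₁ > 0` and `U₀(c) > 0` such that for `0 < c ≤ c₁`, `0 < U ≤ U₀`, `klBetaMin ≤ β ≤ e^{c/U²}`, `μ ∈ klWindowC`, any thresholds
`Lh, Mh, M0` and rates `CL n ≥ 0`: there is ONE volume `(L₀, M₀)` past them with `CL n / L₀ ≤ ½·tol_n`, at which EVERY block keyed on the class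
(any history `H`; pieces symmetric `C⁴` with tier-1 sizes, (E3c-T), the conjunct `X`, `Ren → H`) yields a frame IN THE CLASS whose local parts are
within HALF the quadratic tolerance at every scale and every real angle. -/
theorem ct_oneVolume_thresholdsJA (G : GeoConsts) (Q : EngConsts) (hG : G.WF) (hQ : Q.WF)
    (A : ℝ → ℝ → ℝ → TrigPolyC4v → Prop) (hAF : ∀ β U μ : ℝ, ∀ K : TrigPolyC4v, A β U μ K → FrameOK (ctRenMs G) U (nScales β) μ K)
    (X : ∀ (L M : ℕ) [NeZero L] [NeZero M], ℝ → ℝ → ℝ → TrigPolyC4v → ℕ → Prop)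
    (hsmP : ∃ c₄ : ℝ, 0 < c₄ ∧ ∃ U₄ : ℝ, 0 < U₄ ∧ ∀ c U β : ℝ, 0 < c → c ≤ c₄ → 0 < U → U ≤ U₄ →
      klBetaMin ≤ β → β ≤ Real.exp (c / U ^ 2) → ∀ μ ∈ klWindowC,
        A β U μ 0 ∧ ∃ d : ℕ,
          (1 + 4 / 3 * (G.SL + Q.SL * |U|) * |U|) * (1 + 2 * (4 / 3 * (G.SL + Q.SL * |U|) * |U|)) *
              (π ^ 6 / (d + 1) * ∑ i ∈ range (nScales β + 1), twoLegBar G Q U 1 i) ≤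
            |U| * ((16 : ℝ) ^ nScales β)⁻¹ / 256 ∧
          ∀ (L M : ℕ) [NeZero L] [NeZero M],
            ∀ K : TrigPolyC4v, A β U μ K → ∀ n : ℕ, n ≤ nScales β →
              (∀ i ≤ n, X L M β U μ K i) → A β U μ (ctIterJ L M d β U μ K n)) :
    ∃ c₁ : ℝ, 0 < c₁ ∧ ∀ c : ℝ, 0 < c → c ≤ c₁ → ∃ U₀ : ℝ, 0 < U₀ ∧
      ∀ μ ∈ klWindowC, ∀ U : ℝ, 0 < U → U ≤ U₀ → ∀ β : ℝ, klBetaMin ≤ β → β ≤ Real.exp (c / U ^ 2) →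
        ∀ (Lh : ℕ) (Mh M0 : ℕ → ℕ) (CL : ℕ → ℝ), (∀ n, 0 ≤ CL n) →
          ∃ (L₀ M₀ : ℕ), 0 < L₀ ∧ 0 < M₀ ∧ Lh ≤ L₀ ∧ Mh L₀ ≤ M₀ ∧ M0 L₀ ≤ M₀ ∧
            (∀ n ≤ nScales β, CL n / L₀ ≤ ctCr G * |U| * klScale klE0 n ^ 2 / klE0 / 2) ∧
            ∀ (_ : NeZero L₀) (_ : NeZero M₀) (H : TrigPolyC4v → ℕ → Prop),
              (∀ K : TrigPolyC4v, A β U μ K → ∀ n : ℕ, n ≤ nScales β →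
                (∀ j < n, RenormalisedAtF L₀ M₀ β U μ K (ctRenMs G) j) →
                  (IsSymmetricFrame (klTwoLegPieceFn L₀ M₀ β U μ K.eval n) ∧
                    ContDiff ℝ 4 (onM (klTwoLegPieceFn L₀ M₀ β U μ K.eval n)) ∧
                    ∀ j ≤ 2, ∀ q : Momentum,
                      ‖iteratedFDeriv ℝ j (onM (klTwoLegPieceFn L₀ M₀ β U μ K.eval n)) q‖ ≤ twoLegBar G Q U j n) ∧
                    FrameLipschitzFnT L₀ M₀ H G Q (ctRenMs G) β U μ K n ∧ X L₀ M₀ β U μ K n ∧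
                      (RenormalisedAtF L₀ M₀ β U μ K (ctRenMs G) n → H K n)) →
              ∃ K : TrigPolyC4v, A β U μ K ∧
                ∀ n ≤ nScales β, ∀ θ : ℝ, |klLocalPart L₀ M₀ β U μ K n θ| ≤ ctCr G * |U| * klScale klE0 n ^ 2 / klE0 / 2 := by
  have hR : ∀ j, 0 ≤ (ctRenMs G).Gfr j := (ctRenMs_WF2 hG).1.2.2
  have hS0 : 0 ≤ G.S 0 := hG.2.2.2.2.2.2.2.2.2.2.2.2.2.2.2.2.2.1 0
  have hS'0 : 0 ≤ Q.S' 0 := hQ.2.2.2.2.1 0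
  have hSL : 0 ≤ G.SL := hG.2.2.2.2.2.2.2.2.2.2.2.2.2.2.2.2.2.2.2
  have hSL' : 0 ≤ Q.SL := hQ.2.2.2.2.2.2.1
  obtain ⟨c₃, hc₃, U₃, hU₃, read⟩ := klLocalPart_eq_partialSumFn_of_frameOK (ctRenMs G) hR
  obtain ⟨c₄, hc₄, U₄, hU₄, smp⟩ := hsmP
  refine ⟨min c₃ c₄, lt_min hc₃ hc₄, fun c hc hcle => ?_⟩
  have hcc₃ : c ≤ c₃ := hcle.trans (min_le_left _ _)
  have hcc₄ : c ≤ c₄ := hcle.trans (min_le_right _ _)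
  have hu₄pos : 0 < 1 / (10 * (Q.S' 0 + 1)) := by positivity
  have hu₅pos : 0 < 3 / (4000 * (G.SL + Q.SL + 1)) := by positivity
  refine ⟨min (min U₃ U₄) (min (min (1 / (10 * (Q.S' 0 + 1))) (3 / (4000 * (G.SL + Q.SL + 1)))) 1),
    lt_min (lt_min hU₃ hU₄) (lt_min (lt_min hu₄pos hu₅pos) one_pos), ?_⟩
  intro μ hμ U hU hUle β hβ hβc Lh Mh M0 CL hCL
  have hU3 : U ≤ U₃ := hUle.trans ((min_le_left _ _).trans (min_le_left _ _))
  have hU4' : U ≤ U₄ := hUle.trans ((min_le_left _ _).trans (min_le_right _ _))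
  have hU4 : U ≤ 1 / (10 * (Q.S' 0 + 1)) := hUle.trans ((min_le_right _ _).trans ((min_le_left _ _).trans (min_le_left _ _)))
  have hU5 : U ≤ 3 / (4000 * (G.SL + Q.SL + 1)) :=
    hUle.trans ((min_le_right _ _).trans ((min_le_left _ _).trans (min_le_right _ _)))
  have hU1 : U ≤ 1 := hUle.trans ((min_le_right _ _).trans (min_le_right _ _))
  have hS0' : Q.S' 0 * |U| ≤ 1 / 10 := sPrime_zero_mul_abs_le hS'0 hU hU4
  have hq : 4 / 3 * (G.SL + Q.SL * |U|) * |U| ≤ 1 / 1000 := contraction_le hSL hSL' hU hU1 hU5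
  obtain ⟨hzero, d, hdcond, smpStep⟩ := smp c U β hc hcc₄ hU hU4' hβ hβc μ hμ
  -- the construction volume: only the rates `CL n / L₀ ≤ ½·tol_n` constrain it
  have htpos : ∀ n ≤ nScales β, 0 < ctCr G * |U| * klScale klE0 n ^ 2 / klE0 / 2 := by
    intro n _
    have hUa : 0 < |U| := abs_pos.2 hU.ne'
    have hcr0 : 0 < ctCr G := by unfold ctCr; positivity
    have he0 : (0 : ℝ) < klE0 := by norm_num [klE0]
    have hΛ : 0 < klScale klE0 n := by unfold klScale; positivity
    positivity
  obtain ⟨L₀, hL₀pos, hL₀min, hL₀rate⟩ :=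
    exists_volume_threshold (N := nScales β) (a := CL) (t := fun n => ctCr G * |U| * klScale klE0 n ^ 2 / klE0 / 2)
      (fun n _ => hCL n) htpos Lh
  have hM₀pos : 0 < max (Mh L₀) (M0 L₀) + 1 := Nat.succ_pos _
  refine ⟨L₀, max (Mh L₀) (M0 L₀) + 1, hL₀pos, hM₀pos, hL₀min, (le_max_left _ _).trans (Nat.le_succ _),
    (le_max_right _ _).trans (Nat.le_succ _), fun n hn => hL₀rate n hn, ?_⟩
  intro _ _ H blk
  -- the Jackson degree `d` comes from the provider with its displacement condition at `m = N`; monotone in `m`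
  set qq : ℝ := 4 / 3 * (G.SL + Q.SL * |U|) * |U| with hqq
  set B1 : ℝ := ∑ i ∈ range (nScales β + 1), twoLegBar G Q U 1 i with hB1
  have hB1 : 0 ≤ B1 := sum_nonneg fun i _ => twoLegBar_nonneg' hG hQ U 1 i
  have hqq0 : 0 ≤ qq := by positivity
  set η : ℝ := π ^ 6 / (d + 1) * B1 with hηdef
  have hη : π ^ 6 / (d + 1) * ∑ i ∈ range (nScales β + 1), twoLegBar G Q U 1 i ≤ η := le_rfl
  have hηw : ∀ m ≤ nScales β, (1 + qq) * (1 + 2 * qq) * η ≤ |U| * ((16 : ℝ) ^ m)⁻¹ / 256 := by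
    intro m hm
    have hmono : |U| * ((16 : ℝ) ^ nScales β)⁻¹ / 256 ≤ |U| * ((16 : ℝ) ^ m)⁻¹ / 256 := by
      have : ((16 : ℝ) ^ nScales β)⁻¹ ≤ ((16 : ℝ) ^ m)⁻¹ :=
        inv_anti₀ (by positivity) (pow_le_pow_right₀ (by norm_num) hm)
      have hUa : 0 ≤ |U| := abs_nonneg U
      nlinarith
    have hkey : (1 + qq) * (1 + 2 * qq) * η ≤ |U| * ((16 : ℝ) ^ nScales β)⁻¹ / 256 := by
      rw [hηdef]; exact hdcond
    exact hkey.trans hmono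
  -- the self-map at this volume and degree, from the provider
  have hsm : ∀ K : TrigPolyC4v, A β U μ K → ∀ n : ℕ, n ≤ nScales β →
      (∀ i ≤ n, X L₀ (max (Mh L₀) (M0 L₀) + 1) β U μ K i) →
        A β U μ (ctIterJ L₀ (max (Mh L₀) (M0 L₀) + 1) d β U μ K n) :=
    fun K hK n hn hX => smpStep L₀ (max (Mh L₀) (M0 L₀) + 1) K hK n hn hX
  -- the reading at the construction volume is EXACT
  have hread : ∀ K : TrigPolyC4v, A β U μ K → ∀ n : ℕ, n ≤ nScales β → ∀ B : ℝ,
      (∀ q : Fin 2 → ℝ, |K.eval q + ∑ i ∈ range (n + 1),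
        klTwoLegPieceFn L₀ (max (Mh L₀) (M0 L₀) + 1) β U μ K.eval i q| ≤ B) →
        ∀ θ : ℝ, |klLocalPart L₀ (max (Mh L₀) (M0 L₀) + 1) β U μ K n θ| ≤ B := by
    intro K hK n _ B hB θ
    rw [read c hc hcc₃ U hU hU3 β hβ hβc μ hμ μ K (hAF β U μ K hK) L₀ (max (Mh L₀) (M0 L₀) + 1) n θ]
    exact hB _
  exact ct_oneVolume_of_readingJEA (L := L₀) (M := max (Mh L₀) (M0 L₀) + 1) hG hQ rfl (hAF β U μ) blk hread hS0' hq hzero d hsm hη hηw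


/-! ## The canonical Jackson degree and today's provider in the abstract shape -/

/-- **The canonical Jackson degree meets the displacement condition**: with `t > 0` (here `t := |U|·16^{−N}/256`), any `B, P` and
`d := ⌈π⁶·B·P/t⌉₊`, one has `P·(π⁶/(d+1)·B) ≤ t`.  (The provider of a degree-capped frame class takes this `d`; its cap must dominate `2d`.) -/
theorem jacksonDeg_cond (B P : ℝ) {t : ℝ} (ht : 0 < t) :
    P * (π ^ 6 / ((⌈π ^ 6 * B * P / t⌉₊ : ℕ) + 1) * B) ≤ t := by
  set d : ℕ := ⌈π ^ 6 * B * P / t⌉₊ with hd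
  have hdpos : (0 : ℝ) < (d : ℝ) + 1 := by positivity
  have hceil : π ^ 6 * B * P / t ≤ (d : ℝ) := Nat.le_ceil _
  have h1 : π ^ 6 * B * P ≤ t * (d : ℝ) := by
    have := (div_le_iff₀ ht).mp hceil
    linarith [mul_comm (d : ℝ) t]
  have h2 : π ^ 6 * B * P ≤ t * ((d : ℝ) + 1) := by nlinarith
  rw [show P * (π ^ 6 / ((d : ℝ) + 1) * B) = π ^ 6 * B * P / ((d : ℝ) + 1) by field_simp]
  rw [div_le_iff₀ hdpos]
  linarith

/-- **Today's frame class and (E3a-MS) text in the abstract shape**: the provider for `A := FrameOK (ctRenMs G)`, `X := TwoLegSizesMSFn … K.eval`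
(zero frame from the allowance sums, canonical Jackson degree, step by `frameOK_jackson_of_multiSlotFn'`).  With it `ct_oneVolume_thresholdsJA`
re-derives `ct_oneVolume_thresholdsJT`'s content (checked seat-side against `countertermP2_klPredsV14`). -/
theorem selfMapProviderA_msBar (G : GeoConsts) (Q : EngConsts) (hG : G.WF) (hQ : Q.WF) :
    ∃ c₄ : ℝ, 0 < c₄ ∧ ∃ U₄ : ℝ, 0 < U₄ ∧ ∀ c U β : ℝ, 0 < c → c ≤ c₄ → 0 < U → U ≤ U₄ →
      klBetaMin ≤ β → β ≤ Real.exp (c / U ^ 2) → ∀ μ ∈ klWindowC,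
        FrameOK (ctRenMs G) U (nScales β) μ 0 ∧ ∃ d : ℕ,
          (1 + 4 / 3 * (G.SL + Q.SL * |U|) * |U|) * (1 + 2 * (4 / 3 * (G.SL + Q.SL * |U|) * |U|)) *
              (π ^ 6 / (d + 1) * ∑ i ∈ range (nScales β + 1), twoLegBar G Q U 1 i) ≤
            |U| * ((16 : ℝ) ^ nScales β)⁻¹ / 256 ∧
          ∀ (L M : ℕ) [NeZero L] [NeZero M],
            ∀ K : TrigPolyC4v, FrameOK (ctRenMs G) U (nScales β) μ K → ∀ n : ℕ, n ≤ nScales β →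
              (∀ i ≤ n, TwoLegSizesMSFn L M G Q (ctRenMs G) β U μ K.eval i) →
                FrameOK (ctRenMs G) U (nScales β) μ (ctIterJ L M d β U μ K n) := by
  have hR : ∀ j, 0 ≤ (ctRenMs G).Gfr j := (ctRenMs_WF2 hG).1.2.2
  have hSL : 0 ≤ G.SL := hG.2.2.2.2.2.2.2.2.2.2.2.2.2.2.2.2.2.2.2
  have hSL' : 0 ≤ Q.SL := hQ.2.2.2.2.2.2.1
  obtain ⟨c₂, hc₂, U₂, hU₂, thr⟩ := ctRenMs_thresholds (G := G) (Q := Q) hG hQ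
  refine ⟨c₂, hc₂, U₂, hU₂, fun c U β hc hcc hU hUU hβ hβc μ hμ => ?_⟩
  obtain ⟨hroomA, hroomB, h0, h1, h2⟩ := thr c U β hc.le hcc hU hUU hβ hβc
  have hroom := sharpRoom_of_rooms (G := G) (Q := Q) hR hroomA hroomB (nScales β)
  have hμw : μ ∈ Set.Icc (-1.05 : ℝ) (-0.15) := hμ
  set qq : ℝ := 4 / 3 * (G.SL + Q.SL * |U|) * |U| with hqq
  set B1 : ℝ := ∑ i ∈ range (nScales β + 1), twoLegBar G Q U 1 i with hB1
  have ht : 0 < |U| * ((16 : ℝ) ^ nScales β)⁻¹ / 256 := by have hUa : 0 < |U| := abs_pos.2 hU.ne'; positivity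
  refine ⟨frameOK_zero_of_sums hR hμw h0 h1 h2, ⌈π ^ 6 * B1 * ((1 + qq) * (1 + 2 * qq)) / (|U| * ((16 : ℝ) ^ nScales β)⁻¹ / 256)⌉₊,
    jacksonDeg_cond B1 _ ht, fun L M _ _ K hK n hn hX => ?_⟩
  exact frameOK_jackson_of_multiSlotFn' (L := L) (M := M) hG hQ hR hn hμw hX (hroom n hn) h0 h1 h2 _

end Summit.HubbardSuperconductivity.HubbardSuperconductivity.Theorems.KLRegimeSplit

end
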